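import Mathlib.Combinatorics.SimpleGraph.Basic
import Mathlib.Data.Fin.VecNotation
import Mathlib.Data.Finite.Sum
import Mathlib.Data.Prod.Lex
import Mathlib.Data.Set.Card
import Mathlib.Order.Hom.Basic
import Mathlib.Tactic.FinCases
import HarnessLib

/-!
# Order dimension (Dushnik–Miller) and the dimension of grid intersection graphs

Family `pnp`, layer `Literature/Combinatorics/Posets`. Consumer: the route
`Summits/PneNP/PneNP/Theses/BISOrderDimension` (cruxes `DimFourBISHard`, `DimThreeBISHard`,
support `DimSixtyFourBISHard`), which encodes "an order of Dushnik–Miller dimension `≤ d`" as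
`d` coordinate rows of an `ℕ`-matrix: `j ≤ i ↔ ∀ k < d, M k j ≤ M k i`. Source read, verbatim
(S. Chaplick, S. Felsner, U. Hoffmann, V. Wiechert, *Grid Intersection Graphs and Order Dimension*,
Order 35 (2018) 363–391 = arXiv:1512.02482, pp. 3–4 and 7 of the arXiv text):

* §1.1: "A grid intersection graph (GIG) is an intersection graph of horizontal and vertical
  segments in the plane where parallel segments do not intersect."
* §1.1: "Every bipartite graph `G = (A, B; E)` is the comparability graph of a height-2 poset,
  denoted `Q_G`, where `A` is the set of minimal elements, `B` is the set of maximal elements, and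
  for each `a ∈ A`, `b ∈ B` we have `a ≤ b` in `Q_G` if and only if `a` and `b` are adjacent in `G`.
  For the sake of brevity we define the dimension of a bipartite graph `G` to be equal to the
  dimension of `Q_G`."
* §1.2: "A family `𝓡` of linear extensions of `P` is a realizer of `P` if `P = ⋂_{i ∈ 𝓡} L_i` […]
  The dimension of `P`, denoted `dim(P)`, is the minimum size of a realizer of `P`. This notion of
  dimension for partial orders was defined by Dushnik and Miller. The dimension of `P` can,
  alternatively, be defined as the minimum `t` such that `P` admits an order preserving embedding
  into the product order on `ℝᵗ`, i.e., we can associate a `t`-vector `(x₁, …, x_t)` of reals for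
  each element `x ∈ X` such that `x ≤_P y` if and only if `xᵢ ≤ yᵢ` for all `i ∈ {1, …, t}`."
* §3, Proposition 6: "For every GIG `G`, `{L_←, L_→, L_↑, L_↓}` is a realizer of `G`." (hence
  `dim(G) ≤ 4`), where "In each of the directions left, right, top and bottom we consider the
  orthogonal projection of the segments onto a directed horizontal or vertical line. […] For
  minimal elements we take the minimal point in the interval in the direction of the line, for
  maximal elements we choose the maximal one." Proof: "For two intersecting segments the minimum
  always lies before the maximum […] Every disjoint pair of segments is separated by a horizontal
  or vertical line. The separated vertices appear in different order in the two directions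
  orthogonal to this line."

## Content (all definitions with bodies; all statements PROVED — no named fact)

* `DimLE α d` — **`α` has (Dushnik–Miller) dimension at most `d`**, in the product form of §1.2
  with `ℕ` in place of `ℝ`: there are coordinates `c : α → (Fin d → ℕ)` with
  `a ≤ b ↔ c a ≤ c b` (product = pointwise order). For FINITE orders this is the printed notion:
  a realizer `L₁, …, L_d` gives `c a k :=` position of `a` in `L_k`; conversely `d` coordinate maps
  into ANY chains compress to `ℕ`-valued ones (`DimLE.exists_nat_coord`, `DimLE.of_chains`:
  replace a chain value by the number of elements strictly below it) and `ℕᵈ ⊆ ℝᵈ`; from an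
  `ℕᵈ`-embedding one gets `d` linear extensions by breaking the ties of the `k`-th coordinate
  lexicographically with the others. API: `DimLE.mono`, `DimLE.of_map`, `DimLE.of_orderEmbedding`,
  `DimLE.nonempty_orderEmbedding` (for a partial order, `DimLE α d ↔ Nonempty (α ↪o (Fin d → ℕ))`),
  `DimLE.iff_coord` (the route's "`d` coordinate rows" form `a ≤ b ↔ ∀ k, c k a ≤ c k b`).
* `GridRepresentation κ H V` — a grid intersection representation with horizontal segments indexed
  by `H` (`y`-coordinate `hy`, `x`-interval `[hl, hr]`) and vertical segments indexed by `V`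
  (`x`-coordinate `vx`, `y`-interval `[vb, vt]`) over any linear order `κ` of coordinates (the
  paper: the plane, `κ = ℝ`), "parallel segments do not intersect" being the fields
  `disjoint_h`, `disjoint_v` (two distinct collinear parallel segments have disjoint intervals);
  `R.Cross h v` (the closed segments meet), `R.graph : SimpleGraph (H ⊕ V)` (the intersection
  graph, bipartite with classes `H`, `V`: `graph_adj_inl_inr`, `not_graph_adj_inl_inl`,
  `not_graph_adj_inr_inr`), and the height-2 order `Q_G` as the relation `R.le` on `H ⊕ V`
  (horizontal = minimal, vertical = maximal, `inl h ≤ inr v ↔ R.Cross h v`) together with the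
  `PartialOrder` instance on the synonym `R.Poset`.
* **Proposition 6, PROVED**: `GridRepresentation.le_iff_coords` — `Q_G` is the intersection of the
  four lexicographic "projection" orders `coordRight` (`L_→`: `h ↦ hl h`, `v ↦ vx v`), `coordLeft`
  (`L_←`: `h ↦ hr h`, `v ↦ vx v`, reversed), `coordUp` (`L_↑`: `h ↦ hy h`, `v ↦ vt v`), `coordDown`
  (`L_↓`: `h ↦ hy h`, `v ↦ vb v`, reversed), minimal elements placed before maximal ones at equal
  projection (the tie-break the paper obtains from general position); hence
  `GridRepresentation.exists_coord_four` / `GridRepresentation.dimLE_four`: **the order of a finite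
  grid intersection graph has dimension at most `4`**, with the explicit coordinates of the paper.
  No general-position or non-degeneracy hypothesis is needed.

Not here: Schnyder's theorem (a graph is planar iff its vertex–edge incidence order has dimension
`≤ 3`, Schnyder 1989 Thms. 1–2) and Hartman–Newman–Ziv 1991 (every planar bipartite graph is a grid
intersection graph) — both are statements about PLANARITY, for which neither Mathlib nor the tree
has a definition (searched: `IsPlanar`/`Planar` declarations, 0 relevant hits); they are to be
vendored once a planarity notion (e.g. rotation systems of genus `0`) lands. Cor. 1 of the paper
(3-DORGs have dimension `≤ 3`) and the `2k² − 2k + 4` realizer for height-2 orders of degree `k`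
(route rationale of `DimSixtyFourBISHard`) are likewise not in this file.

## References

* [ChaplickEtAl2018] S. Chaplick, S. Felsner, U. Hoffmann, V. Wiechert, Grid Intersection Graphs
  and Order Dimension, Order 35 (2018) 363–391, §1.1, §1.2, §3 Prop. 6 (arXiv:1512.02482 pp. 3–4, 7).
* [DushnikMiller1941] B. Dushnik, E. W. Miller, Partially ordered sets, Amer. J. Math. 63 (1941)
  600–610 (origin of the dimension of a partial order).
* [Schnyder1989] W. Schnyder, Planar graphs and poset dimension, Order 5 (1989) 323–343.
* [HartmanNewmanZiv1991] I. Ben-Arroyo Hartman, I. Newman, R. Ziv, On grid intersection graphs,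
  Discrete Math. 87 (1991) 41–52.
-/

namespace Literature.Combinatorics.Posets

/-! ### Dushnik–Miller dimension at most `d` -/

/-- **`α` has (Dushnik–Miller) order dimension at most `d`** (product form): there are
coordinates `c : α → (Fin d → ℕ)` such that `a ≤ b ↔ c a ≤ c b` for the product (pointwise)
order on `Fin d → ℕ` — "the minimum `t` such that `P` admits an order preserving embedding into
the product order on `ℝᵗ` […] `x ≤_P y` if and only if `xᵢ ≤ yᵢ` for all `i`", with `ℕ` for `ℝ`
(equivalent for finite orders: `DimLE.of_chains`). Stated for any `LE`; for a partial order it is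
`Nonempty (α ↪o (Fin d → ℕ))` (`DimLE.nonempty_orderEmbedding`). [cite: ChaplickEtAl2018, §1.2] -/
def DimLE (α : Type*) [LE α] (d : ℕ) : Prop :=
  ∃ c : α → Fin d → ℕ, ∀ a b : α, a ≤ b ↔ c a ≤ c b

namespace DimLE

variable {α β : Type*}

/-- Coordinate-row form: `DimLE α d` iff there are `d` maps `c k : α → ℕ` with
`a ≤ b ↔ ∀ k, c k a ≤ c k b` (the shape "`j ≤ i ↔ ∀ k < d, M k j ≤ M k i`" of the route's
matrix encoding). [cite: ChaplickEtAl2018, §1.2] -/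
theorem iff_coord [LE α] {d : ℕ} :
    DimLE α d ↔ ∃ c : Fin d → α → ℕ, ∀ a b : α, a ≤ b ↔ ∀ k, c k a ≤ c k b := by
  constructor
  · rintro ⟨c, hc⟩
    exact ⟨fun k a => c a k, fun a b => (hc a b).trans Pi.le_def⟩
  · rintro ⟨c, hc⟩
    exact ⟨fun a k => c k a, fun a b => (hc a b).trans Pi.le_def.symm⟩

/-- Dimension `≤ d` transfers along any map that preserves and reflects `≤` (in particular to
induced suborders). [cite: ChaplickEtAl2018, §1.2] -/
theorem of_map [LE α] [LE β] {d : ℕ} (f : β → α) (hf : ∀ a b : β, a ≤ b ↔ f a ≤ f b)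
    (h : DimLE α d) : DimLE β d := by
  obtain ⟨c, hc⟩ := h
  exact ⟨c ∘ f, fun a b => (hf a b).trans (hc _ _)⟩

/-- Dimension `≤ d` transfers along order embeddings (dimension is monotone under taking
suborders). [cite: ChaplickEtAl2018, §1.2] -/
theorem of_orderEmbedding [LE α] [LE β] {d : ℕ} (f : β ↪o α) (h : DimLE α d) : DimLE β d :=
  h.of_map f fun _ _ => f.map_rel_iff.symm

/-- `DimLE` is monotone in `d` (pad with constant coordinates). [cite: ChaplickEtAl2018, §1.2] -/
theorem mono [LE α] {d d' : ℕ} (hd : d ≤ d') (h : DimLE α d) : DimLE α d' := by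
  obtain ⟨c, hc⟩ := h
  refine ⟨fun a k => if hk : (k : ℕ) < d then c a ⟨k, hk⟩ else 0, fun a b => (hc a b).trans ?_⟩
  simp only [Pi.le_def]
  constructor
  · intro h k
    by_cases hk : (k : ℕ) < d
    · rw [dif_pos hk, dif_pos hk]
      exact h _
    · rw [dif_neg hk, dif_neg hk]
  · intro h k
    have hk := h (Fin.castLE hd k)
    have e : ((Fin.castLE hd k : Fin d') : ℕ) < d := k.isLt
    rw [dif_pos e, dif_pos e] at hk
    exact hk

/-- For a partial order, coordinates as in `DimLE` form an order embedding into `ℕᵈ`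
(antisymmetry gives injectivity). [cite: ChaplickEtAl2018, §1.2] -/
theorem nonempty_orderEmbedding [PartialOrder α] {d : ℕ} (h : DimLE α d) :
    Nonempty (α ↪o (Fin d → ℕ)) := by
  obtain ⟨c, hc⟩ := h
  exact ⟨OrderEmbedding.ofMapLEIff c fun a b => (hc a b).symm⟩

/-- An order embedding into `ℕᵈ` witnesses dimension `≤ d`. [cite: ChaplickEtAl2018, §1.2] -/
theorem of_orderEmbedding_nat [LE α] {d : ℕ} (e : α ↪o (Fin d → ℕ)) : DimLE α d :=
  ⟨e, fun _ _ => e.map_rel_iff.symm⟩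

/-- For a partial order, `DimLE α d ↔ Nonempty (α ↪o (Fin d → ℕ))`. [cite: ChaplickEtAl2018, §1.2] -/
theorem iff_nonempty_orderEmbedding [PartialOrder α] {d : ℕ} :
    DimLE α d ↔ Nonempty (α ↪o (Fin d → ℕ)) :=
  ⟨nonempty_orderEmbedding, fun ⟨e⟩ => of_orderEmbedding_nat e⟩

/-- **Compression of a chain-valued coordinate to `ℕ`** on a finite carrier: replacing the value
`g a` in a linear order by the number of elements strictly below it preserves and reflects `≤`
(this is why `ℕᵈ`, `ℝᵈ` and "`d` linear extensions" give the same dimension for finite orders).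
[cite: ChaplickEtAl2018, §1.2] -/
theorem exists_nat_coord [Finite α] {C : Type*} [LinearOrder C] (g : α → C) :
    ∃ f : α → ℕ, ∀ a b : α, g a ≤ g b ↔ f a ≤ f b := by
  refine ⟨fun a => Set.ncard {x | g x < g a}, fun a b => ⟨fun h => ?_, fun h => ?_⟩⟩
  · exact Set.ncard_le_ncard (fun x (hx : g x < g a) => lt_of_lt_of_le hx h) (Set.toFinite _)
  · by_contra hba
    replace hba : g b < g a := not_le.mp hba
    have hss : {x | g x < g b} ⊂ {x | g x < g a} := by
      rw [Set.ssubset_def]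
      exact ⟨fun x (hx : g x < g b) => hx.trans hba, fun hsub => lt_irrefl _ (hsub hba)⟩
    exact absurd h (not_le.mpr (Set.ncard_lt_ncard hss (Set.toFinite _)))

/-- `d` coordinate maps into a chain with `a ≤ b ↔ ∀ k, g k a ≤ g k b` witness `DimLE α d` on a
finite carrier (compress each coordinate to `ℕ`). [cite: ChaplickEtAl2018, §1.2] -/
theorem of_chains [LE α] [Finite α] {d : ℕ} {C : Type*} [LinearOrder C] (g : Fin d → α → C)
    (hg : ∀ a b : α, a ≤ b ↔ ∀ k, g k a ≤ g k b) : DimLE α d := by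
  choose f hf using fun k => exists_nat_coord (g k)
  exact iff_coord.2 ⟨f, fun a b => (hg a b).trans (forall_congr' fun k => hf k a b)⟩

end DimLE

/-! ### Grid intersection representations -/

/-- A **grid intersection representation**: horizontal segments `h : H` (on the line `y = hy h`,
with `x`-interval `[hl h, hr h]`) and vertical segments `v : V` (on the line `x = vx v`, with
`y`-interval `[vb v, vt v]`) in the "plane" `κ × κ` over a linear order `κ` of coordinates, such
that "parallel segments do not intersect": two distinct horizontal (vertical) segments on a common
line have disjoint intervals. Its intersection graph `R.graph` is a grid intersection graph (GIG)
with colour classes `H`, `V`. [cite: ChaplickEtAl2018, §1.1] -/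
structure GridRepresentation (κ : Type*) [LinearOrder κ] (H V : Type*) where
  /-- The `y`-coordinate of the horizontal segment `h`. -/
  hy : H → κ
  /-- The left endpoint (`x`-coordinate) of the horizontal segment `h`. -/
  hl : H → κ
  /-- The right endpoint (`x`-coordinate) of the horizontal segment `h`. -/
  hr : H → κ
  /-- Segments are intervals: `hl h ≤ hr h`. -/
  hl_le_hr : ∀ h, hl h ≤ hr h
  /-- The `x`-coordinate of the vertical segment `v`. -/
  vx : V → κ
  /-- The bottom endpoint (`y`-coordinate) of the vertical segment `v`. -/
  vb : V → κ
  /-- The top endpoint (`y`-coordinate) of the vertical segment `v`. -/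
  vt : V → κ
  /-- Segments are intervals: `vb v ≤ vt v`. -/
  vb_le_vt : ∀ v, vb v ≤ vt v
  /-- Parallel segments do not intersect: distinct horizontal segments on one line are disjoint. -/
  disjoint_h : ∀ ⦃h h' : H⦄, h ≠ h' → hy h = hy h' → hr h < hl h' ∨ hr h' < hl h
  /-- Parallel segments do not intersect: distinct vertical segments on one line are disjoint. -/
  disjoint_v : ∀ ⦃v v' : V⦄, v ≠ v' → vx v = vx v' → vt v < vb v' ∨ vt v' < vb v

namespace GridRepresentation

variable {κ : Type*} [LinearOrder κ] {H V : Type*} (R : GridRepresentation κ H V)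

/-- The horizontal segment `h` and the vertical segment `v` **intersect** (as closed segments):
`hl h ≤ vx v ≤ hr h` and `vb v ≤ hy h ≤ vt v`. [cite: ChaplickEtAl2018, §1.1] -/
def Cross (h : H) (v : V) : Prop :=
  R.hl h ≤ R.vx v ∧ R.vx v ≤ R.hr h ∧ R.vb v ≤ R.hy h ∧ R.hy h ≤ R.vt v

/-- The **intersection graph** of the representation on `H ⊕ V` (a grid intersection graph):
`inl h ~ inr v` iff the segments intersect; no edges inside `H` or inside `V`.
[cite: ChaplickEtAl2018, §1.1] -/
def graph : SimpleGraph (H ⊕ V) :=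
  SimpleGraph.fromRel fun p q => ∃ h v, p = Sum.inl h ∧ q = Sum.inr v ∧ R.Cross h v

/-- Adjacency between a horizontal and a vertical segment is intersection. [cite: ChaplickEtAl2018, §1.1] -/
@[simp]
theorem graph_adj_inl_inr (h : H) (v : V) : R.graph.Adj (Sum.inl h) (Sum.inr v) ↔ R.Cross h v := by
  simp only [graph, SimpleGraph.fromRel_adj, ne_eq, reduceCtorEq, not_false_eq_true, true_and]
  constructor
  · rintro (⟨h', v', hh, hv, hc⟩ | ⟨h', v', hh, _, _⟩)
    · cases hh; cases hv; exact hc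
    · cases hh
  · exact fun hc => Or.inl ⟨h, v, rfl, rfl, hc⟩

/-- Adjacency is symmetric: `inr v ~ inl h` iff the segments intersect. [cite: ChaplickEtAl2018, §1.1] -/
@[simp]
theorem graph_adj_inr_inl (h : H) (v : V) : R.graph.Adj (Sum.inr v) (Sum.inl h) ↔ R.Cross h v := by
  rw [SimpleGraph.adj_comm, graph_adj_inl_inr]

/-- Horizontal segments are pairwise non-adjacent (the graph is bipartite with classes `H`, `V`).
[cite: ChaplickEtAl2018, §1.1] -/
@[simp]
theorem not_graph_adj_inl_inl (h h' : H) : ¬ R.graph.Adj (Sum.inl h) (Sum.inl h') := by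
  simp only [graph, SimpleGraph.fromRel_adj, ne_eq, not_and]
  rintro - (⟨_, _, _, hv, _⟩ | ⟨_, _, _, hv, _⟩) <;> cases hv

/-- Vertical segments are pairwise non-adjacent. [cite: ChaplickEtAl2018, §1.1] -/
@[simp]
theorem not_graph_adj_inr_inr (v v' : V) : ¬ R.graph.Adj (Sum.inr v) (Sum.inr v') := by
  simp only [graph, SimpleGraph.fromRel_adj, ne_eq, not_and]
  rintro - (⟨_, _, hh, _, _⟩ | ⟨_, _, hh, _, _⟩) <;> cases hh

/-! ### The height-2 order `Q_G` of the representation -/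

/-- The **height-2 order `Q_G`** of the intersection graph, as a relation on `H ⊕ V`: horizontal
segments are minimal, vertical segments maximal, and `inl h ≤ inr v` iff `h` and `v` intersect
("`a ≤ b` in `Q_G` if and only if `a` and `b` are adjacent in `G`"). [cite: ChaplickEtAl2018, §1.1] -/
protected def le : H ⊕ V → H ⊕ V → Prop
  | Sum.inl h, Sum.inl h' => h = h'
  | Sum.inl h, Sum.inr v => R.Cross h v
  | Sum.inr _, Sum.inl _ => False
  | Sum.inr v, Sum.inr v' => v = v'

/-- Two horizontal segments are comparable in `Q_G` only when equal (both minimal).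
[cite: ChaplickEtAl2018, §1.1] -/
@[simp] theorem le_inl_inl (h h' : H) : R.le (Sum.inl h) (Sum.inl h') ↔ h = h' := Iff.rfl

/-- `inl h ≤ inr v` in `Q_G` iff the segments intersect. [cite: ChaplickEtAl2018, §1.1] -/
@[simp] theorem le_inl_inr (h : H) (v : V) : R.le (Sum.inl h) (Sum.inr v) ↔ R.Cross h v := Iff.rfl

/-- A vertical (maximal) segment is never below a horizontal (minimal) one. [cite: ChaplickEtAl2018, §1.1] -/
@[simp] theorem not_le_inr_inl (v : V) (h : H) : ¬ R.le (Sum.inr v) (Sum.inl h) := fun hf => hf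

/-- Two vertical segments are comparable in `Q_G` only when equal (both maximal).
[cite: ChaplickEtAl2018, §1.1] -/
@[simp] theorem le_inr_inr (v v' : V) : R.le (Sum.inr v) (Sum.inr v') ↔ v = v' := Iff.rfl

/-- `Q_G` is reflexive. [cite: ChaplickEtAl2018, §1.1] -/
theorem le_refl (p : H ⊕ V) : R.le p p := by
  cases p <;> simp

/-- `Q_G` is transitive (it has height `2`). [cite: ChaplickEtAl2018, §1.1] -/
theorem le_trans {p q r : H ⊕ V} (hpq : R.le p q) (hqr : R.le q r) : R.le p r := by
  rcases p with h | v <;> rcases q with h' | v' <;> rcases r with h'' | v'' <;>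
    simp only [le_inl_inl, le_inl_inr, le_inr_inr, not_le_inr_inl] at hpq hqr ⊢
  · exact hpq.trans hqr
  · exact hpq ▸ hqr
  · exact hqr ▸ hpq
  · exact hpq.trans hqr

/-- `Q_G` is antisymmetric. [cite: ChaplickEtAl2018, §1.1] -/
theorem le_antisymm {p q : H ⊕ V} (hpq : R.le p q) (hqp : R.le q p) : p = q := by
  rcases p with h | v <;> rcases q with h' | v' <;>
    simp only [le_inl_inl, le_inr_inr, not_le_inr_inl] at hpq hqp ⊢
  · exact congrArg Sum.inl hpq
  · exact congrArg Sum.inr hpq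

/-- The carrier `H ⊕ V` of the order `Q_G`, as a type synonym carrying the `PartialOrder`
instance `R.le` (the parameter `R` only indexes the instance). [cite: ChaplickEtAl2018, §1.1] -/
def Poset (_R : GridRepresentation κ H V) : Type _ := H ⊕ V

/-- The identification `H ⊕ V ≃ R.Poset`. [cite: ChaplickEtAl2018, §1.1] -/
def toPoset : H ⊕ V ≃ R.Poset := Equiv.refl _

/-- `Q_G` is a partial order on `R.Poset = H ⊕ V` (of height `2`). [cite: ChaplickEtAl2018, §1.1] -/
instance instPartialOrderPoset : PartialOrder R.Poset where
  le := R.le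
  le_refl := R.le_refl
  le_trans _ _ _ := R.le_trans
  le_antisymm _ _ := R.le_antisymm

/-- `R.Poset` is finite when `H` and `V` are. [folklore] -/
instance instFinitePoset [Finite H] [Finite V] : Finite R.Poset := inferInstanceAs (Finite (H ⊕ V))

/-- The order of `R.Poset` is `R.le`. [cite: ChaplickEtAl2018, §1.1] -/
@[simp]
theorem toPoset_le_toPoset (p q : H ⊕ V) : R.toPoset p ≤ R.toPoset q ↔ R.le p q := Iff.rfl

/-! ### Proposition 6: the four projection orders `L_→, L_←, L_↑, L_↓` realize `Q_G` -/

/-- `L_→`: project onto a horizontal line directed to the right; minimal elements (horizontal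
segments) take their minimal point `hl h`, vertical segments the point `vx v`; at equal projection
minimal elements come first. [cite: ChaplickEtAl2018, §3 Prop. 6] -/
def coordRight : H ⊕ V → κ ×ₗ Fin 2
  | Sum.inl h => toLex (R.hl h, 0)
  | Sum.inr v => toLex (R.vx v, 1)

/-- `L_←`: project onto a horizontal line directed to the left (coordinates reversed); horizontal
segments take `hr h`, vertical segments `vx v`. [cite: ChaplickEtAl2018, §3 Prop. 6] -/
def coordLeft : H ⊕ V → κᵒᵈ ×ₗ Fin 2
  | Sum.inl h => toLex (OrderDual.toDual (R.hr h), 0)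
  | Sum.inr v => toLex (OrderDual.toDual (R.vx v), 1)

/-- `L_↑`: project onto a vertical line directed upwards; horizontal segments take `hy h`, maximal
elements (vertical segments) their maximal point `vt v`. [cite: ChaplickEtAl2018, §3 Prop. 6] -/
def coordUp : H ⊕ V → κ ×ₗ Fin 2
  | Sum.inl h => toLex (R.hy h, 0)
  | Sum.inr v => toLex (R.vt v, 1)

/-- `L_↓`: project onto a vertical line directed downwards (coordinates reversed); horizontal
segments take `hy h`, vertical segments their maximal point in that direction, `vb v`.
[cite: ChaplickEtAl2018, §3 Prop. 6] -/
def coordDown : H ⊕ V → κᵒᵈ ×ₗ Fin 2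
  | Sum.inl h => toLex (OrderDual.toDual (R.hy h), 0)
  | Sum.inr v => toLex (OrderDual.toDual (R.vb v), 1)

/-- Equal tags: the lexicographic order compares the first coordinates. [folklore] -/
private theorem toLex_le_toLex_same {α : Type*} [LinearOrder α] {a b : α} {i : Fin 2} :
    toLex (a, i) ≤ toLex (b, i) ↔ a ≤ b := by
  rw [Prod.Lex.toLex_le_toLex]
  exact ⟨fun h => h.elim le_of_lt fun h => h.1.le, fun h => h.lt_or_eq.imp id fun e => ⟨e, le_rfl⟩⟩

/-- Tag `0` against tag `1`: ties go to the smaller tag. [folklore] -/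
private theorem toLex_zero_le_toLex_one {α : Type*} [LinearOrder α] {a b : α} :
    toLex (a, (0 : Fin 2)) ≤ toLex (b, 1) ↔ a ≤ b := by
  rw [Prod.Lex.toLex_le_toLex]
  exact ⟨fun h => h.elim le_of_lt fun h => h.1.le,
    fun h => h.lt_or_eq.imp id fun e => ⟨e, Fin.zero_le _⟩⟩

/-- Tag `1` against tag `0`: only a strict inequality of first coordinates. [folklore] -/
private theorem toLex_one_le_toLex_zero {α : Type*} [LinearOrder α] {a b : α} :
    toLex (a, (1 : Fin 2)) ≤ toLex (b, 0) ↔ a < b := by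
  rw [Prod.Lex.toLex_le_toLex]
  exact ⟨fun h => h.elim id fun h => absurd h.2 (show ¬ ((1 : Fin 2) ≤ 0) by decide), Or.inl⟩

/-- **Chaplick–Felsner–Hoffmann–Wiechert, Prop. 6** (the realizer): `p ≤ q` in `Q_G` iff `p`
precedes `q` in each of `L_→, L_←, L_↑, L_↓` — "For two intersecting segments the minimum always
lies before the maximum […] Every disjoint pair of segments is separated by a horizontal or vertical
line. The separated vertices appear in different order in the two directions orthogonal to this
line"; two distinct parallel segments are reversed by the pair of opposite directions along their
common orientation, or, when collinear, by the two projections along it (they are disjoint).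
[cite: ChaplickEtAl2018, §3 Prop. 6] -/
theorem le_iff_coords (p q : H ⊕ V) :
    R.le p q ↔ R.coordRight p ≤ R.coordRight q ∧ R.coordLeft p ≤ R.coordLeft q ∧
      R.coordUp p ≤ R.coordUp q ∧ R.coordDown p ≤ R.coordDown q := by
  rcases p with h | v <;> rcases q with h' | v'
  · -- two horizontal segments
    simp only [le_inl_inl, coordRight, coordLeft, coordUp, coordDown, toLex_le_toLex_same,
      OrderDual.toDual_le_toDual]
    refine ⟨fun e => e ▸ ⟨le_rfl, le_rfl, le_rfl, le_rfl⟩, fun ⟨h1, h2, h3, h4⟩ => ?_⟩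
    by_contra hne
    rcases R.disjoint_h hne (_root_.le_antisymm h3 h4) with h5 | h5
    · exact absurd (h5.trans_le ((R.hl_le_hr h').trans h2)) (lt_irrefl _)
    · exact absurd (h5.trans_le (h1.trans (R.hl_le_hr h'))) (lt_irrefl _)
  · -- horizontal below vertical: the comparable case
    simp only [le_inl_inr, Cross, coordRight, coordLeft, coordUp, coordDown,
      toLex_zero_le_toLex_one, OrderDual.toDual_le_toDual]
    constructor
    · rintro ⟨h1, h2, h3, h4⟩
      exact ⟨h1, h2, h4, h3⟩
    · rintro ⟨h1, h2, h3, h4⟩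
      exact ⟨h1, h2, h4, h3⟩
  · -- vertical below horizontal: never
    simp only [not_le_inr_inl, coordRight, coordLeft, toLex_one_le_toLex_zero,
      OrderDual.toDual_lt_toDual, false_iff, not_and]
    intro h1 h2
    exact absurd ((h1.trans_le (R.hl_le_hr h')).trans h2) (lt_irrefl _)
  · -- two vertical segments
    simp only [le_inr_inr, coordRight, coordLeft, coordUp, coordDown, toLex_le_toLex_same,
      OrderDual.toDual_le_toDual]
    refine ⟨fun e => e ▸ ⟨le_rfl, le_rfl, le_rfl, le_rfl⟩, fun ⟨h1, h2, h3, h4⟩ => ?_⟩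
    by_contra hne
    rcases R.disjoint_v hne (_root_.le_antisymm h1 h2) with h5 | h5
    · exact absurd (h5.trans_le (h4.trans (R.vb_le_vt v))) (lt_irrefl _)
    · exact absurd (h5.trans_le ((R.vb_le_vt v).trans h3)) (lt_irrefl _)

/-- **Prop. 6, coordinate form**: for a finite grid intersection representation there are four
`ℕ`-valued coordinate maps `c : H ⊕ V → (Fin 4 → ℕ)` with `p ≤ q` in `Q_G` iff `c p ≤ c q`
pointwise (the ranks in `L_→, L_←, L_↑, L_↓`). [cite: ChaplickEtAl2018, §3 Prop. 6] -/
theorem exists_coord_four [Finite H] [Finite V] :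
    ∃ c : H ⊕ V → Fin 4 → ℕ, ∀ p q : H ⊕ V, R.le p q ↔ c p ≤ c q := by
  obtain ⟨f₀, hf₀⟩ := DimLE.exists_nat_coord R.coordRight
  obtain ⟨f₁, hf₁⟩ := DimLE.exists_nat_coord R.coordLeft
  obtain ⟨f₂, hf₂⟩ := DimLE.exists_nat_coord R.coordUp
  obtain ⟨f₃, hf₃⟩ := DimLE.exists_nat_coord R.coordDown
  refine ⟨fun p => ![f₀ p, f₁ p, f₂ p, f₃ p], fun p q => ?_⟩
  rw [R.le_iff_coords, hf₀, hf₁, hf₂, hf₃, Pi.le_def]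
  constructor
  · rintro ⟨h0, h1, h2, h3⟩ k
    fin_cases k
    · simpa using h0
    · simpa using h1
    · simpa using h2
    · simpa using h3
  · intro hk
    exact ⟨by simpa using hk 0, by simpa using hk 1, by simpa using hk 2, by simpa using hk 3⟩

/-- **The order of a finite grid intersection graph has dimension at most `4`**
(`dim(G) ≤ 4` for every GIG `G`). [cite: ChaplickEtAl2018, §3 Prop. 6] -/
theorem dimLE_four [Finite H] [Finite V] : DimLE R.Poset 4 :=
  R.exists_coord_four

end GridRepresentation

end Literature.Combinatorics.Posets
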